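import Literature.AlgebraicTopology.Homotopy.SequenceTelescopeCW
import HarnessLib

/-!
# Attaching arbitrarily many cells to a CW complex gives a CW complex

Topic `Literature/AlgebraicTopology/Homotopy`. The adjunction space `Z ∪_φ ⊔ᵢ Dᵈ` of a space
`Z` and a family of `d`-discs attached along maps `φᵢ : S^{d-1} → Z`, for an index type `ι` of
ANY universe and size (Hatcher, *Algebraic Topology* (2002), Ch. 0 p. 5 and p. 7, "attaching
cells"; Appendix, Prop. A.2: the weak topology), and the theorem that attaching `d`-cells to a
Hausdorff CW complex all of whose cells have dimension `< d` gives a Hausdorff CW complex whose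
cells are the old ones and one `d`-cell per disc (Hatcher p. 5: "`Xⁿ` is formed from `Xⁿ⁻¹` by
attaching `n`-cells"; Prop. A.2 and A.3). The sibling files `DiscAttachment.lean`,
`DiscAttachmentCW.lean` treat the same construction for index types in `Type` and FINITE
attachments to finite complexes (the Morse-theoretic use); the CW approximation theorem
(`CWApproximation.lean`, Hatcher Prop. 4.13) needs index sets as large as the set of all maps of
a sphere into the previous stage, whence this universe-polymorphic, infinite version. PROVED:

* `CellAttach.Space φ` — the points in normal form: `Z ⊕ Σ i, (open unit ball)`, topologised as
  the quotient of `Z ⊔ ⊔ᵢ Dᵈ` (`CellAttach.proj`, a quotient map by construction); the closed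
  embedding `CellAttach.inZ : Z → Z ∪_φ ⊔ᵢ Dᵈ`, the characteristic maps `CellAttach.chi i`
  (total on `ℝᵈ` through the radial clamp, the inclusion of the open ball on the open ball and
  `inZ ∘ φᵢ` on the sphere), the universal property `CellAttach.desc`;
* `CellAttach.instT2Space` — Hausdorff if `Z` is (collar extension of open sets of `Z`);
* `CellAttach.instCWComplex` — for `Z` a Hausdorff CW complex with no cells of dimension `≥ d`,
  the CW structure on `Z ∪_φ ⊔ᵢ Dᵈ` with cells `cell Z m ⊕ {i // m = d}`; closure finiteness of
  the new cells by Hatcher's Prop. A.1 (`exists_finset_closedCell_cover_of_isCompact`,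
  `SequenceTelescopeCW.lean`), weak topology from the quotient topology;
* bookkeeping for towers: `closedCell_inl/inr`, `isEmpty_cell`, `skeletonLT_subset_image_inZ`
  (the cells of dimension `< k ≤ d` are old), `isCellularMap_inZ`.

No named facts, no `sorry`.

## References

* A. Hatcher, *Algebraic Topology*, CUP (2002), Ch. 0 pp. 5, 7; Appendix, Prop. A.1–A.3
  (pp. 519–523). [HatcherAT2002]
-/

noncomputable section

open Set Function Metric Topology

universe u w v

namespace Literature.AlgebraicTopology.Homotopy

namespace CellAttach

/-- Local notation: the model closed disc, open disc and sphere in `ℝᵈ` (sup norm). -/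
local notation "𝔻 " d:arg => Metric.closedBall (0 : Fin d → ℝ) 1
local notation "𝔹 " d:arg => Metric.ball (0 : Fin d → ℝ) 1
local notation "𝕊 " d:arg => Metric.sphere (0 : Fin d → ℝ) 1

variable {Z : Type u} [TopologicalSpace Z] {ι : Type w} {d : ℕ} (φ : ι → C(↥(𝕊 d), Z))

/-! ### The radial clamp `ℝᵈ → Dᵈ` -/

/-- The radial clamp `y ↦ y / max 1 ‖y‖` of `ℝᵈ` onto the closed unit disc. [folklore] -/
def clamp (y : Fin d → ℝ) : Fin d → ℝ := (max 1 ‖y‖)⁻¹ • y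

/-- The clamp is continuous. [folklore] -/
theorem continuous_clamp : Continuous (clamp (d := d)) :=
  ((continuous_const.max continuous_norm).inv₀ fun _ =>
    (lt_of_lt_of_le one_pos (le_max_left _ _)).ne').smul continuous_id

/-- The clamp lands in the closed disc. [folklore] -/
theorem clamp_mem (y : Fin d → ℝ) : clamp y ∈ 𝔻 d := by
  rw [mem_closedBall_zero_iff, clamp, norm_smul, norm_inv, Real.norm_eq_abs,
    abs_of_pos (lt_of_lt_of_le one_pos (le_max_left _ _))]
  exact inv_mul_le_one_of_le₀ (le_max_right _ _) (le_trans zero_le_one (le_max_left _ _))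

/-- The clamp fixes the closed disc. [folklore] -/
theorem clamp_of_mem {y : Fin d → ℝ} (hy : y ∈ 𝔻 d) : clamp y = y := by
  rw [mem_closedBall_zero_iff] at hy
  simp [clamp, max_eq_left hy]

/-! ### The space -/

/-- A point of the open disc, as a point of the closed disc. [folklore] -/
def discPt (x : ↥(𝔹 d)) : ↥(𝔻 d) := ⟨x, ball_subset_closedBall x.2⟩

/-- Coercion of `discPt`. [folklore] -/
@[simp] theorem coe_discPt (x : ↥(𝔹 d)) : (discPt x : Fin d → ℝ) = x := rfl

/-- **The adjunction space `Z ∪_φ ⊔ᵢ Dᵈ` in normal form**: a point is a point of `Z` or an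
interior point of one of the discs (boundary points of the discs being identified with their
attaching images). [cite: HatcherAT2002, Ch. 0 p. 7] -/
structure Space (φ : ι → C(↥(𝕊 d), Z)) : Type (max u w) where
  /-- the normal form: a point of `Z` or an interior point of a disc -/
  val : Z ⊕ (Σ _ : ι, ↥(𝔹 d))

/-- The disjoint union `Z ⊔ ⊔ᵢ Dᵈ` before gluing. [folklore] -/
abbrev Pre (_φ : ι → C(↥(𝕊 d), Z)) : Type (max u w) := Z ⊕ (Σ _ : ι, ↥(𝔻 d))

/-- A point of `Z` as a point of `Z ∪_φ ⊔ᵢ Dᵈ` (the function; the continuous map is `inZ`).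
[folklore] -/
def ofZ (z : Z) : Space φ := ⟨Sum.inl z⟩

/-- An interior point of the `i`-th disc as a point of `Z ∪_φ ⊔ᵢ Dᵈ`. [folklore] -/
def ofBall (i : ι) (x : ↥(𝔹 d)) : Space φ := ⟨Sum.inr ⟨i, x⟩⟩

/-- `ofZ` is injective. [folklore] -/
theorem ofZ_injective : Injective (ofZ φ) := fun z z' h => by
  simpa [ofZ] using congrArg Space.val h

/-- `ofBall` points coincide only trivially. [folklore] -/
theorem ofBall_eq_ofBall_iff {i i' : ι} {x x' : ↥(𝔹 d)} : ofBall φ i x = ofBall φ i' x' ↔ i = i' ∧ x = x' := by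
  constructor
  · intro h
    have h' := congrArg Space.val h
    simp only [ofBall, Sum.inr.injEq] at h'
    obtain ⟨rfl, h2⟩ := Sigma.mk.inj_iff.1 h'
    exact ⟨rfl, eq_of_heq h2⟩
  · rintro ⟨rfl, rfl⟩; rfl

/-- `ofBall` points are not in `Z`. [folklore] -/
theorem ofBall_ne_ofZ (i : ι) (x : ↥(𝔹 d)) (z : Z) : ofBall φ i x ≠ ofZ φ z := fun h => by
  have h' := congrArg Space.val h
  simp [ofBall, ofZ] at h'

/-- A point of the closed disc off the open disc lies on the sphere. [folklore] -/
theorem mem_sphere_of_not_lt {x : Fin d → ℝ} (hx : x ∈ 𝔻 d) (h : ¬ ‖x‖ < 1) : x ∈ 𝕊 d := by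
  rw [mem_closedBall_zero_iff] at hx
  exact mem_sphere_zero_iff_norm.2 (le_antisymm hx (not_lt.1 h))

/-- The gluing map on one closed disc: interior points to themselves, boundary points to their
attaching image. [folklore] -/
def glue (i : ι) (x : ↥(𝔻 d)) : Space φ :=
  if h : ‖(x : Fin d → ℝ)‖ < 1 then ofBall φ i ⟨x, mem_ball_zero_iff.2 h⟩
  else ofZ φ (φ i ⟨x, mem_sphere_of_not_lt x.2 h⟩)

/-- `glue` on an interior point. [folklore] -/
theorem glue_of_lt (i : ι) {x : ↥(𝔻 d)} (h : ‖(x : Fin d → ℝ)‖ < 1) :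
    glue φ i x = ofBall φ i ⟨x, mem_ball_zero_iff.2 h⟩ := dif_pos h

/-- `glue` on a boundary point. [folklore] -/
theorem glue_of_norm_eq (i : ι) {x : ↥(𝔻 d)} (h : ‖(x : Fin d → ℝ)‖ = 1) :
    glue φ i x = ofZ φ (φ i ⟨x, mem_sphere_zero_iff_norm.2 h⟩) := by
  have h' : ¬ ‖(x : Fin d → ℝ)‖ < 1 := by rw [h]; exact lt_irrefl _
  rw [glue, dif_neg h']

/-- `glue` of an interior point presented through `discPt`. [folklore] -/
@[simp] theorem glue_discPt (i : ι) (x : ↥(𝔹 d)) : glue φ i (discPt x) = ofBall φ i x :=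
  glue_of_lt φ i (mem_ball_zero_iff.1 x.2)

/-- The quotient map `Z ⊔ ⊔ᵢ Dᵈ → Z ∪_φ ⊔ᵢ Dᵈ`. [cite: HatcherAT2002, Ch. 0 p. 7] -/
def proj : Pre φ → Space φ
  | Sum.inl z => ofZ φ z
  | Sum.inr ⟨i, x⟩ => glue φ i x

/-- The quotient topology. [cite: HatcherAT2002, Ch. 0 p. 7] -/
instance instTopologicalSpace : TopologicalSpace (Space φ) :=
  TopologicalSpace.coinduced (proj φ) inferInstance

/-- `proj` is surjective. [folklore] -/
theorem proj_surjective : Surjective (proj φ) := by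
  rintro ⟨z | ⟨i, x⟩⟩
  · exact ⟨Sum.inl z, rfl⟩
  · exact ⟨Sum.inr ⟨i, discPt x⟩, glue_discPt φ i x⟩

/-- `proj` is continuous. [folklore] -/
theorem continuous_proj : Continuous (proj φ) :=
  continuous_coinduced_rng

/-- Open sets of `Z ∪_φ ⊔ᵢ Dᵈ`: those whose traces on `Z` and on every closed disc are open.
[cite: HatcherAT2002, Prop. A.2] -/
theorem isOpen_iff {U : Set (Space φ)} :
    IsOpen U ↔ IsOpen (ofZ φ ⁻¹' U) ∧ ∀ i, IsOpen (glue φ i ⁻¹' U) := by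
  change IsOpen (proj φ ⁻¹' U) ↔ _
  rw [isOpen_sum_iff, isOpen_sigma_iff]
  exact Iff.rfl

/-- Closed sets of `Z ∪_φ ⊔ᵢ Dᵈ`: those whose traces on `Z` and on every closed disc are closed.
[cite: HatcherAT2002, Prop. A.2] -/
theorem isClosed_iff {A : Set (Space φ)} :
    IsClosed A ↔ IsClosed (ofZ φ ⁻¹' A) ∧ ∀ i, IsClosed (glue φ i ⁻¹' A) := by
  rw [← isOpen_compl_iff, isOpen_iff, ← isOpen_compl_iff]
  refine and_congr Iff.rfl (forall_congr' fun i => ?_)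
  rw [← isOpen_compl_iff]; exact Iff.rfl

/-- **Continuity of maps out of `Z ∪_φ ⊔ᵢ Dᵈ`** is checked on `Z` and on each closed disc.
[folklore] -/
theorem continuous_iff {Y : Type v} [TopologicalSpace Y] {g : Space φ → Y} :
    Continuous g ↔ Continuous (g ∘ ofZ φ) ∧ ∀ i, Continuous (g ∘ glue φ i) := by
  rw [continuous_coinduced_dom, continuous_sum_dom, continuous_sigma_iff]
  exact Iff.rfl

/-- `glue` is continuous. [folklore] -/
theorem continuous_glue (i : ι) : Continuous (glue φ i) :=
  ((continuous_iff φ).1 continuous_id).2 i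

/-! ### The base and the characteristic maps -/

/-- The embedding `Z → Z ∪_φ ⊔ᵢ Dᵈ`. [cite: HatcherAT2002, Ch. 0 p. 7] -/
def inZ : C(Z, Space φ) := ⟨ofZ φ, ((continuous_iff φ).1 continuous_id).1⟩

/-- `inZ` is `ofZ`. [folklore] -/
@[simp] theorem inZ_apply (z : Z) : inZ φ z = ofZ φ z := rfl

/-- `inZ` is injective. [folklore] -/
theorem inZ_injective : Injective (inZ φ) := ofZ_injective φ

/-- **The characteristic map of the `i`-th cell**, as a total map `ℝᵈ → Z ∪_φ ⊔ᵢ Dᵈ` (radial clamp,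
then glue). [cite: HatcherAT2002, Ch. 0 p. 7] -/
def chi (i : ι) (y : Fin d → ℝ) : Space φ := glue φ i ⟨clamp y, clamp_mem y⟩

/-- `chi` is continuous. [folklore] -/
theorem continuous_chi (i : ι) : Continuous (chi φ i) :=
  (continuous_glue φ i).comp (continuous_clamp.subtype_mk _)

/-- `chi` on the closed disc is `glue`. [folklore] -/
theorem chi_of_mem (i : ι) {y : Fin d → ℝ} (hy : y ∈ 𝔻 d) : chi φ i y = glue φ i ⟨y, hy⟩ := by
  unfold chi
  congr 1
  exact Subtype.ext (clamp_of_mem hy)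

/-- `chi` on the open disc is the inclusion of the open cell. [folklore] -/
theorem chi_of_mem_ball (i : ι) {y : Fin d → ℝ} (hy : y ∈ 𝔹 d) : chi φ i y = ofBall φ i ⟨y, hy⟩ := by
  rw [chi_of_mem φ i (ball_subset_closedBall hy), glue_of_lt φ i (mem_ball_zero_iff.1 hy)]

/-- `chi` on the sphere is the attaching map. [cite: HatcherAT2002, Ch. 0 p. 7] -/
theorem chi_of_mem_sphere (i : ι) {y : Fin d → ℝ} (hy : y ∈ 𝕊 d) : chi φ i y = inZ φ (φ i ⟨y, hy⟩) := by
  rw [chi_of_mem φ i (sphere_subset_closedBall hy), glue_of_norm_eq φ i (mem_sphere_zero_iff_norm.1 hy)]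
  rfl

/-- Every point is in `Z` or in an open cell. [folklore] -/
theorem exists_eq (m : Space φ) : (∃ z, m = inZ φ z) ∨ ∃ i, ∃ y ∈ 𝔹 d, m = chi φ i y := by
  rcases m with ⟨z | ⟨i, x⟩⟩
  · exact Or.inl ⟨z, rfl⟩
  · exact Or.inr ⟨i, x, x.2, by rw [chi_of_mem_ball φ i x.2]; rfl⟩

/-- A point of an open cell is not in `Z`. [folklore] -/
theorem chi_ne_inZ (i : ι) {y : Fin d → ℝ} (hy : y ∈ 𝔹 d) (z : Z) : chi φ i y ≠ inZ φ z := by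
  rw [chi_of_mem_ball φ i hy]; exact ofBall_ne_ofZ φ i _ z

/-- Points of open cells coincide only trivially. [folklore] -/
theorem chi_eq_chi_iff {i i' : ι} {y y' : Fin d → ℝ} (hy : y ∈ 𝔹 d) (hy' : y' ∈ 𝔹 d) :
    chi φ i y = chi φ i' y' ↔ i = i' ∧ y = y' := by
  rw [chi_of_mem_ball φ i hy, chi_of_mem_ball φ i' hy', ofBall_eq_ofBall_iff]
  simp only [Subtype.mk.injEq]

/-- `chi i` is injective on the open disc. [folklore] -/
theorem injOn_chi (i : ι) : InjOn (chi φ i) (𝔹 d) := fun _ hy _ hy' h =>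
  ((chi_eq_chi_iff φ hy hy').1 h).2

/-- The function underlying `desc`. [folklore] -/
def descFun {Y : Type v} (h : Z → Y) (k : ι → ↥(𝔻 d) → Y) : Space φ → Y
  | ⟨Sum.inl z⟩ => h z
  | ⟨Sum.inr p⟩ => k p.1 (discPt p.2)

/-- **Universal property**: a map on `Z` and maps on the closed discs, compatible along the
attaching maps, define a continuous map on `Z ∪_φ ⊔ᵢ Dᵈ`. [cite: HatcherAT2002, Ch. 0 p. 7] -/
def desc {Y : Type v} [TopologicalSpace Y] (h : C(Z, Y)) (k : ι → C(↥(𝔻 d), Y))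
    (hk : ∀ i (x : ↥(𝕊 d)), k i ⟨x, sphere_subset_closedBall x.2⟩ = h (φ i x)) : C(Space φ, Y) where
  toFun := descFun φ h fun i => k i
  continuous_toFun := by
    refine (continuous_iff φ).2 ⟨h.continuous, fun i => ?_⟩
    have heq : (descFun φ h fun i => k i) ∘ glue φ i = k i := by
      funext x
      by_cases hx : ‖(x : Fin d → ℝ)‖ < 1
      · simp only [comp_apply, glue_of_lt φ i hx]; rfl
      · have hx1 : ‖(x : Fin d → ℝ)‖ = 1 :=
          le_antisymm (mem_closedBall_zero_iff.1 x.2) (not_lt.1 hx)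
        simp only [comp_apply, glue_of_norm_eq φ i hx1]
        exact (hk i ⟨x, mem_sphere_zero_iff_norm.2 hx1⟩).symm
    rw [heq]; exact (k i).continuous

/-- `desc` on `Z`. [folklore] -/
@[simp] theorem desc_inZ {Y : Type v} [TopologicalSpace Y] (h : C(Z, Y)) (k : ι → C(↥(𝔻 d), Y))
    (hk : ∀ i (x : ↥(𝕊 d)), k i ⟨x, sphere_subset_closedBall x.2⟩ = h (φ i x)) (z : Z) :
    desc φ h k hk (inZ φ z) = h z := rfl

/-- `desc` on the closed discs. [folklore] -/
theorem desc_chi {Y : Type v} [TopologicalSpace Y] (h : C(Z, Y)) (k : ι → C(↥(𝔻 d), Y))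
    (hk : ∀ i (x : ↥(𝕊 d)), k i ⟨x, sphere_subset_closedBall x.2⟩ = h (φ i x)) (i : ι) {y : Fin d → ℝ}
    (hy : y ∈ 𝔻 d) : desc φ h k hk (chi φ i y) = k i ⟨y, hy⟩ := by
  by_cases h1 : ‖y‖ < 1
  · rw [chi_of_mem_ball φ i (mem_ball_zero_iff.2 h1)]; rfl
  · have h2 : ‖y‖ = 1 := le_antisymm (mem_closedBall_zero_iff.1 hy) (not_lt.1 h1)
    rw [chi_of_mem_sphere φ i (mem_sphere_zero_iff_norm.2 h2), desc_inZ, ← hk]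

/-! ### Open and closed sets; `inZ` is a closed embedding, the open cells are open -/

/-- The trace of `inZ '' A` on a closed disc: the boundary points attached into `A`. [folklore] -/
theorem glue_preimage_image_inZ (i : ι) (A : Set Z) :
    glue φ i ⁻¹' (inZ φ '' A) = {x : ↥(𝔻 d) | ∃ h : ‖(x : Fin d → ℝ)‖ = 1, φ i ⟨x, mem_sphere_zero_iff_norm.2 h⟩ ∈ A} := by
  ext x
  constructor
  · rintro ⟨z, hz, hzx⟩
    rw [inZ_apply] at hzx
    by_cases hx : ‖(x : Fin d → ℝ)‖ < 1
    · rw [glue_of_lt φ i hx] at hzx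
      exact absurd hzx.symm (ofBall_ne_ofZ φ i _ z)
    · have hx1 : ‖(x : Fin d → ℝ)‖ = 1 := le_antisymm (mem_closedBall_zero_iff.1 x.2) (not_lt.1 hx)
      refine ⟨hx1, ?_⟩
      rw [glue_of_norm_eq φ i hx1] at hzx
      rw [← ofZ_injective φ hzx]; exact hz
  · rintro ⟨hx1, hA⟩
    exact ⟨_, hA, (glue_of_norm_eq φ i hx1).symm⟩

/-- **`inZ` is a closed embedding.** [cite: HatcherAT2002, Ch. 0 p. 7] -/
theorem isClosedEmbedding_inZ : IsClosedEmbedding (inZ φ) := by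
  refine IsClosedEmbedding.of_continuous_injective_isClosedMap (inZ φ).continuous (inZ_injective φ)
    fun A hA => ?_
  rw [isClosed_iff]
  refine ⟨?_, fun i => ?_⟩
  · have : ofZ φ ⁻¹' (inZ φ '' A) = A := by
      ext z
      simp only [mem_preimage, mem_image, inZ_apply]
      exact ⟨fun ⟨z', hz', h⟩ => ofZ_injective φ h ▸ hz', fun hz => ⟨z, hz, rfl⟩⟩
    rw [this]; exact hA
  · rw [glue_preimage_image_inZ]
    -- `{x : ‖x‖ = 1, φ i x ∈ A}` is the image of the closed set `φ i ⁻¹ A` under the sphere inclusion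
    have heq : {x : ↥(𝔻 d) | ∃ h : ‖(x : Fin d → ℝ)‖ = 1, φ i ⟨x, mem_sphere_zero_iff_norm.2 h⟩ ∈ A} =
        inclusion (sphere_subset_closedBall : (𝕊 d) ⊆ 𝔻 d) '' (φ i ⁻¹' A) := by
      ext x
      constructor
      · rintro ⟨hx1, hA⟩
        exact ⟨⟨x, mem_sphere_zero_iff_norm.2 hx1⟩, hA, Subtype.ext rfl⟩
      · rintro ⟨s, hs, rfl⟩
        exact ⟨mem_sphere_zero_iff_norm.1 s.2, by simpa using hs⟩
    rw [heq]
    haveI : CompactSpace ↥(𝕊 d) := isCompact_iff_compactSpace.1 (isCompact_sphere _ _)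
    exact ((hA.preimage (φ i).continuous).isCompact.image
      (continuous_inclusion sphere_subset_closedBall)).isClosed

/-- The trace of the image of a subset of the open disc on the closed discs. [folklore] -/
theorem glue_preimage_image_chi (i i' : ι) {U : Set (Fin d → ℝ)} (hU : U ⊆ 𝔹 d) :
    glue φ i' ⁻¹' (chi φ i '' U) = {x : ↥(𝔻 d) | i' = i ∧ (x : Fin d → ℝ) ∈ U} := by
  ext x
  constructor
  · rintro ⟨y, hyU, hyx⟩
    rw [chi_of_mem_ball φ i (hU hyU)] at hyx
    by_cases hx : ‖(x : Fin d → ℝ)‖ < 1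
    · rw [glue_of_lt φ i' hx, ofBall_eq_ofBall_iff] at hyx
      obtain ⟨rfl, h2⟩ := hyx
      have h3 : y = (x : Fin d → ℝ) := congrArg Subtype.val h2
      exact ⟨rfl, h3 ▸ hyU⟩
    · have hx1 : ‖(x : Fin d → ℝ)‖ = 1 := le_antisymm (mem_closedBall_zero_iff.1 x.2) (not_lt.1 hx)
      rw [glue_of_norm_eq φ i' hx1] at hyx
      exact absurd hyx (ofBall_ne_ofZ φ i _ _)
  · rintro ⟨rfl, hxU⟩
    refine ⟨x, hxU, ?_⟩
    rw [chi_of_mem_ball φ i' (hU hxU), glue_of_lt φ i' (mem_ball_zero_iff.1 (hU hxU))]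

/-- **The image of an open subset of the open disc under `chi i` is open.** [folklore] -/
theorem isOpen_image_chi (i : ι) {U : Set (Fin d → ℝ)} (hUo : IsOpen U) (hU : U ⊆ 𝔹 d) :
    IsOpen (chi φ i '' U) := by
  classical
  rw [isOpen_iff]
  refine ⟨?_, fun i' => ?_⟩
  · have : ofZ φ ⁻¹' (chi φ i '' U) = ∅ := by
      ext z
      simp only [mem_preimage, mem_image, mem_empty_iff_false, iff_false, not_exists, not_and]
      intro y hy h
      exact chi_ne_inZ φ i (hU hy) z h
    rw [this]; exact isOpen_empty
  · rw [glue_preimage_image_chi φ i i' hU]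
    by_cases h : i' = i
    · simp only [h, true_and]
      exact hUo.preimage continuous_subtype_val
    · simp only [h, false_and, setOf_false, isOpen_empty]

/-- The open cells are open. [folklore] -/
theorem isOpen_image_chi_ball (i : ι) : IsOpen (chi φ i '' 𝔹 d) :=
  isOpen_image_chi φ i isOpen_ball Subset.rfl

/-! ### Hausdorffness -/

section T2

/-- The punctured space `{y ≠ 0}` of `ℝᵈ` (as `‖y‖ ≠ 0`). [folklore] -/
def Punct (d : ℕ) : Set (Fin d → ℝ) := {y | ‖y‖ ≠ 0}

/-- The punctured space is open. [folklore] -/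
theorem isOpen_punct : IsOpen (Punct d) :=
  isOpen_ne_fun continuous_norm continuous_const

/-- The radial projection of the punctured space onto the sphere. [folklore] -/
def radial (p : ↥(Punct d)) : ↥(𝕊 d) :=
  ⟨‖(p : Fin d → ℝ)‖⁻¹ • (p : Fin d → ℝ), by
    rw [mem_sphere_zero_iff_norm, norm_smul, norm_inv, norm_norm, inv_mul_cancel₀ p.2]⟩

/-- The radial projection is continuous. [folklore] -/
theorem continuous_radial : Continuous (radial (d := d)) :=
  Continuous.subtype_mk (((continuous_norm.comp continuous_subtype_val).inv₀ fun p => p.2).smul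
    continuous_subtype_val) _

/-- On the sphere the radial projection is the identity. [folklore] -/
theorem radial_of_norm_eq_one {y : Fin d → ℝ} (hy : ‖y‖ = 1) (h0 : ‖y‖ ≠ 0) :
    radial ⟨y, h0⟩ = ⟨y, mem_sphere_zero_iff_norm.2 hy⟩ :=
  Subtype.ext (by simp [radial, hy])

/-- The part of the `i`-th model disc beyond radius `ρ` radially attached into `U`. [folklore] -/
def core (U : Set Z) (ρ : ℝ) (i : ι) : Set (Fin d → ℝ) :=
  Subtype.val '' {p : ↥(Punct d) | ρ < ‖(p : Fin d → ℝ)‖ ∧ φ i (radial p) ∈ U}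

/-- Membership in `core`. [folklore] -/
theorem mem_core_iff {U : Set Z} {ρ : ℝ} {i : ι} {y : Fin d → ℝ} :
    y ∈ core φ U ρ i ↔ ∃ h0 : ‖y‖ ≠ 0, ρ < ‖y‖ ∧ φ i (radial ⟨y, h0⟩) ∈ U := by
  constructor
  · rintro ⟨p, hp, rfl⟩; exact ⟨p.2, hp⟩
  · rintro ⟨h0, h⟩; exact ⟨⟨y, h0⟩, h, rfl⟩

/-- `core` of an open set is open. [folklore] -/
theorem isOpen_core {U : Set Z} (hU : IsOpen U) (ρ : ℝ) (i : ι) : IsOpen (core φ U ρ i) :=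
  isOpen_punct.isOpenMap_subtype_val _
    ((isOpen_lt continuous_const (continuous_norm.comp continuous_subtype_val)).inter
      (hU.preimage ((φ i).continuous.comp continuous_radial)))

/-- **The collar extension** of `U ⊆ Z` beyond radius `ρ`: `U` together with the points of the
open cells beyond radius `ρ` whose radial projection is attached into `U` (Hatcher, *Algebraic
Topology* (2002), proof of Prop. A.3, the sets `N_ε(A)`). [cite: HatcherAT2002, Prop. A.3 (proof)] -/
def collar (U : Set Z) (ρ : ℝ) : Set (Space φ) :=
  inZ φ '' U ∪ ⋃ i, chi φ i '' (core φ U ρ i ∩ 𝔹 d)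

/-- `U` lies in its collar. [folklore] -/
theorem image_subset_collar (U : Set Z) (ρ : ℝ) : inZ φ '' U ⊆ collar φ U ρ := subset_union_left

/-- The trace of the collar on `Z` is `U`. [folklore] -/
theorem ofZ_preimage_collar (U : Set Z) (ρ : ℝ) : ofZ φ ⁻¹' collar φ U ρ = U := by
  ext z
  simp only [collar, mem_preimage, mem_union, mem_image, inZ_apply, mem_iUnion, mem_inter_iff]
  constructor
  · rintro (⟨z', hz', h⟩ | ⟨i, y, ⟨-, hy⟩, h⟩)
    · exact ofZ_injective φ h ▸ hz'
    · exact absurd h (chi_ne_inZ φ i hy z)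
  · exact fun h => Or.inl ⟨z, h, rfl⟩

/-- The trace of the collar on the `i`-th closed disc, for `ρ < 1`: the trace of `core`. [folklore] -/
theorem glue_preimage_collar (U : Set Z) {ρ : ℝ} (hρ : ρ < 1) (i : ι) :
    glue φ i ⁻¹' collar φ U ρ = (Subtype.val : ↥(𝔻 d) → Fin d → ℝ) ⁻¹' core φ U ρ i := by
  ext x
  have key : ∀ i', glue φ i x ∈ chi φ i' '' (core φ U ρ i' ∩ 𝔹 d) ↔ i = i' ∧ (x : Fin d → ℝ) ∈ core φ U ρ i' ∩ 𝔹 d :=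
    fun i' => Set.ext_iff.1 (glue_preimage_image_chi φ i' i inter_subset_right) x
  have key0 : glue φ i x ∈ inZ φ '' U ↔ ∃ h : ‖(x : Fin d → ℝ)‖ = 1, φ i ⟨x, mem_sphere_zero_iff_norm.2 h⟩ ∈ U :=
    Set.ext_iff.1 (glue_preimage_image_inZ φ i U) x
  simp only [collar, mem_preimage, mem_union, mem_iUnion, key, key0]
  constructor
  · rintro (⟨hx1, hU⟩ | ⟨i', rfl, h1, -⟩)
    · rw [mem_core_iff]
      refine ⟨by rw [hx1]; exact one_ne_zero, by rw [hx1]; exact hρ, ?_⟩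
      rw [radial_of_norm_eq_one hx1]; exact hU
    · exact h1
  · intro hx
    by_cases h1 : ‖(x : Fin d → ℝ)‖ < 1
    · exact Or.inr ⟨i, rfl, hx, mem_ball_zero_iff.2 h1⟩
    · have hx1 : ‖(x : Fin d → ℝ)‖ = 1 := le_antisymm (mem_closedBall_zero_iff.1 x.2) (not_lt.1 h1)
      obtain ⟨h0, -, hU⟩ := (mem_core_iff φ).1 hx
      rw [radial_of_norm_eq_one hx1] at hU
      exact Or.inl ⟨hx1, hU⟩

/-- **The collar extension of an open set is open** (`ρ < 1`). [cite: HatcherAT2002, Prop. A.3 (proof)] -/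
theorem isOpen_collar {U : Set Z} (hU : IsOpen U) {ρ : ℝ} (hρ : ρ < 1) : IsOpen (collar φ U ρ) := by
  rw [isOpen_iff, ofZ_preimage_collar]
  exact ⟨hU, fun i => by rw [glue_preimage_collar φ U hρ i]; exact (isOpen_core φ hU ρ i).preimage continuous_subtype_val⟩

/-- Membership of a point of an open cell in a collar. [folklore] -/
theorem chi_mem_collar_iff {U : Set Z} {ρ : ℝ} {i : ι} {y : Fin d → ℝ} (hy : y ∈ 𝔹 d) :
    chi φ i y ∈ collar φ U ρ ↔ y ∈ core φ U ρ i := by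
  simp only [collar, mem_union, mem_image, mem_iUnion, mem_inter_iff]
  constructor
  · rintro (⟨z, -, h⟩ | ⟨i', y', ⟨hc, hy'⟩, h⟩)
    · exact absurd h.symm (chi_ne_inZ φ i hy z)
    · obtain ⟨rfl, rfl⟩ := (chi_eq_chi_iff φ hy' hy).1 h
      exact hc
  · exact fun h => Or.inr ⟨i, y, ⟨h, hy⟩, rfl⟩

/-- Collars of disjoint sets are disjoint. [folklore] -/
theorem disjoint_collar {U U' : Set Z} (h : Disjoint U U') (ρ : ℝ) : Disjoint (collar φ U ρ) (collar φ U' ρ) := by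
  refine Set.disjoint_left.2 fun m hm hm' => ?_
  rcases exists_eq φ m with ⟨z, rfl⟩ | ⟨i, y, hy, rfl⟩
  · have h1 : z ∈ ofZ φ ⁻¹' collar φ U ρ := hm
    have h2 : z ∈ ofZ φ ⁻¹' collar φ U' ρ := hm'
    rw [ofZ_preimage_collar] at h1 h2
    exact Set.disjoint_left.1 h h1 h2
  · rw [chi_mem_collar_iff φ hy, mem_core_iff] at hm hm'
    obtain ⟨h0, -, hU⟩ := hm
    obtain ⟨h0', -, hU'⟩ := hm'
    exact Set.disjoint_left.1 h hU hU'

/-- A point of `Z` and a point of an open cell are separated. [folklore] -/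
theorem separated_inZ_chi (z : Z) (i : ι) {y : Fin d → ℝ} (hy : y ∈ 𝔹 d) :
    ∃ u v : Set (Space φ), IsOpen u ∧ IsOpen v ∧ inZ φ z ∈ u ∧ chi φ i y ∈ v ∧ Disjoint u v := by
  set ρ : ℝ := (‖y‖ + 1) / 2 with hρ
  have hy1 : ‖y‖ < 1 := mem_ball_zero_iff.1 hy
  have hρ1 : ρ < 1 := by rw [hρ]; linarith
  have hyρ : ‖y‖ < ρ := by rw [hρ]; linarith
  refine ⟨collar φ univ ρ, chi φ i '' ball 0 ρ, isOpen_collar φ isOpen_univ hρ1,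
    isOpen_image_chi φ i isOpen_ball (ball_subset_ball hρ1.le), image_subset_collar φ univ ρ ⟨z, mem_univ _, rfl⟩,
    ⟨y, mem_ball_zero_iff.2 hyρ, rfl⟩, Set.disjoint_left.2 ?_⟩
  rintro m hm ⟨y', hy', rfl⟩
  have hy'1 : y' ∈ 𝔹 d := ball_subset_ball hρ1.le hy'
  rw [chi_mem_collar_iff φ hy'1, mem_core_iff] at hm
  obtain ⟨-, hlt, -⟩ := hm
  exact absurd (mem_ball_zero_iff.1 hy') (not_lt.2 hlt.le)

/-- **`Z ∪_φ ⊔ᵢ Dᵈ` is Hausdorff when `Z` is** (Hatcher, *Algebraic Topology* (2002), Prop. A.3: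
CW complexes — built by attaching cells — are Hausdorff, indeed normal). [cite: HatcherAT2002, Prop. A.3] -/
instance instT2Space [T2Space Z] : T2Space (Space φ) := by
  refine (t2Space_iff _).2 fun m m' hne => ?_
  rcases exists_eq φ m with ⟨z, rfl⟩ | ⟨i, y, hy, rfl⟩ <;> rcases exists_eq φ m' with ⟨z', rfl⟩ | ⟨i', y', hy', rfl⟩
  · have hzz : z ≠ z' := fun h => hne (by rw [h])
    obtain ⟨U, U', hU, hU', hz, hz', hd⟩ := t2_separation hzz
    exact ⟨collar φ U (1 / 2), collar φ U' (1 / 2), isOpen_collar φ hU (by norm_num), isOpen_collar φ hU' (by norm_num),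
      image_subset_collar φ U _ ⟨z, hz, rfl⟩, image_subset_collar φ U' _ ⟨z', hz', rfl⟩, disjoint_collar φ hd _⟩
  · exact separated_inZ_chi φ z i' hy'
  · obtain ⟨u, v, hu, hv, hzu, hyv, hd⟩ := separated_inZ_chi φ z' i hy
    exact ⟨v, u, hv, hu, hyv, hzu, hd.symm⟩
  · by_cases hii : i = i'
    · subst hii
      have hyy : y ≠ y' := fun h => hne (by rw [h])
      obtain ⟨O, O', hO, hO', hyO, hyO', hd⟩ := t2_separation hyy
      refine ⟨chi φ i '' (O ∩ 𝔹 d), chi φ i '' (O' ∩ 𝔹 d), isOpen_image_chi φ i (hO.inter isOpen_ball) inter_subset_right,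
        isOpen_image_chi φ i (hO'.inter isOpen_ball) inter_subset_right, ⟨y, ⟨hyO, hy⟩, rfl⟩, ⟨y', ⟨hyO', hy'⟩, rfl⟩,
        Set.disjoint_left.2 ?_⟩
      rintro _ ⟨w, ⟨hwO, hw⟩, rfl⟩ ⟨w', ⟨hwO', hw'⟩, h⟩
      obtain ⟨-, rfl⟩ := (chi_eq_chi_iff φ hw' hw).1 h
      exact Set.disjoint_left.1 hd hwO hwO'
    · refine ⟨chi φ i '' 𝔹 d, chi φ i' '' 𝔹 d, isOpen_image_chi_ball φ i, isOpen_image_chi_ball φ i', ⟨y, hy, rfl⟩,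
        ⟨y', hy', rfl⟩, Set.disjoint_left.2 ?_⟩
      rintro _ ⟨w, hw, rfl⟩ ⟨w', hw', h⟩
      exact hii ((chi_eq_chi_iff φ hw' hw).1 h).1.symm

end T2

/-! ### The new cells as partial equivalences -/

/-- The new `d`-cell `i`, as a partial equivalence (open ball onto open cell). [folklore] -/
def newMap (i : ι) : PartialEquiv (Fin d → ℝ) (Space φ) :=
  (injOn_chi φ i).toPartialEquiv (chi φ i) (ball 0 1)

/-- `newMap` as a function. [folklore] -/
@[simp] theorem coe_newMap (i : ι) : (newMap φ i : (Fin d → ℝ) → Space φ) = chi φ i := rfl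

/-- The inverse of `newMap` is continuous on the open cell. [folklore] -/
theorem continuousOn_newMap_symm (i : ι) : ContinuousOn (newMap φ i).symm (newMap φ i).target := by
  have htgt : (newMap φ i).target = chi φ i '' ball 0 1 := rfl
  rw [htgt, continuousOn_open_iff (isOpen_image_chi_ball φ i)]
  intro t ht
  have heq : chi φ i '' ball 0 1 ∩ (newMap φ i).symm ⁻¹' t = chi φ i '' (ball 0 1 ∩ t) := by
    ext m
    constructor
    · rintro ⟨⟨y, hy, rfl⟩, hm⟩
      refine ⟨y, ⟨hy, ?_⟩, rfl⟩
      have : (newMap φ i).symm (chi φ i y) = y := (newMap φ i).left_inv (show y ∈ ball 0 1 from hy)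
      rw [mem_preimage, this] at hm
      exact hm
    · rintro ⟨y, ⟨hy, hyt⟩, rfl⟩
      refine ⟨⟨y, hy, rfl⟩, ?_⟩
      have : (newMap φ i).symm (chi φ i y) = y := (newMap φ i).left_inv (show y ∈ ball 0 1 from hy)
      rw [mem_preimage, this]
      exact hyt
  rw [heq]
  exact isOpen_image_chi φ i (isOpen_ball.inter ht) inter_subset_left

/-! ### The CW structure -/

section CW

variable [CWComplex (univ : Set Z)]

/-- An old cell of `Z` pushed into `Z ∪_φ ⊔ᵢ Dᵈ`, as a partial equivalence. [folklore] -/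
def oldMap (m : ℕ) (j : RelCWComplex.cell (univ : Set Z) m) : PartialEquiv (Fin m → ℝ) (Space φ) where
  toFun := inZ φ ∘ RelCWComplex.map m j
  invFun := descFun φ (RelCWComplex.map m j).symm fun _ _ => 0
  source := ball 0 1
  target := inZ φ '' (RelCWComplex.map m j).target
  map_source' y hy := ⟨_, (RelCWComplex.map m j).map_source (by rw [RelCWComplex.source_eq]; exact hy), rfl⟩
  map_target' := by
    rintro _ ⟨z, hz, rfl⟩
    have := (RelCWComplex.map m j).map_target hz
    rw [RelCWComplex.source_eq] at this
    exact this
  left_inv' y hy := by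
    show (RelCWComplex.map m j).symm (RelCWComplex.map m j y) = y
    exact (RelCWComplex.map m j).left_inv (by rw [RelCWComplex.source_eq]; exact hy)
  right_inv' := by
    rintro _ ⟨z, hz, rfl⟩
    show inZ φ (RelCWComplex.map m j ((RelCWComplex.map m j).symm z)) = inZ φ z
    rw [(RelCWComplex.map m j).right_inv hz]

/-- `oldMap` as a function. [folklore] -/
theorem coe_oldMap (m : ℕ) (j : RelCWComplex.cell (univ : Set Z) m) :
    (oldMap φ m j : (Fin m → ℝ) → Space φ) = inZ φ ∘ RelCWComplex.map m j := rfl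

/-- Images under `oldMap`. [folklore] -/
theorem image_oldMap (m : ℕ) (j : RelCWComplex.cell (univ : Set Z) m) (s : Set (Fin m → ℝ)) :
    oldMap φ m j '' s = inZ φ '' (RelCWComplex.map m j '' s) := by
  rw [coe_oldMap, image_comp]

/-- **The cells of `Z ∪_φ ⊔ᵢ Dᵈ`** in dimension `m`: the cells of `Z`, plus one `d`-cell for each
`i : ι`. [cite: HatcherAT2002, Ch. 0 p. 5] -/
def Cell (_φ : ι → C(↥(𝕊 d), Z)) (m : ℕ) : Type (max u w) :=
  RelCWComplex.cell (univ : Set Z) m ⊕ {_i : ι // m = d}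

/-- The characteristic maps of `Z ∪_φ ⊔ᵢ Dᵈ`. [folklore] -/
def cellMap : (m : ℕ) → Cell φ m → PartialEquiv (Fin m → ℝ) (Space φ)
  | m, Sum.inl j => oldMap φ m j
  | _, Sum.inr ⟨i, rfl⟩ => newMap φ i

/-- `cellMap` on old cells. [folklore] -/
@[simp] theorem cellMap_inl (m : ℕ) (j : RelCWComplex.cell (univ : Set Z) m) : cellMap φ m (Sum.inl j) = oldMap φ m j := rfl

/-- `cellMap` on new cells. [folklore] -/
@[simp] theorem cellMap_inr (i : ι) : cellMap φ d (Sum.inr ⟨i, rfl⟩) = newMap φ i := rfl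

/-- Old open cells are disjoint from new open cells. [folklore] -/
theorem disjoint_image_oldMap_image_chi (m : ℕ) (j : RelCWComplex.cell (univ : Set Z) m) (i : ι) :
    Disjoint (oldMap φ m j '' ball 0 1) (chi φ i '' ball 0 1) := by
  rw [image_oldMap]
  refine Set.disjoint_left.2 ?_
  rintro _ ⟨z, -, rfl⟩ ⟨y, hy, hy'⟩
  exact chi_ne_inZ φ i hy _ hy'

/-- If `Z` has no cells of dimension `≥ d`, every cell of `Z` has dimension `< d`. [folklore] -/
theorem lt_of_cell (hdim : ∀ m, d ≤ m → IsEmpty (RelCWComplex.cell (univ : Set Z) m)) {m : ℕ}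
    (j : RelCWComplex.cell (univ : Set Z) m) : m < d := by
  by_contra h
  exact (hdim m (not_lt.1 h)).false j

variable [T2Space Z]

/-- If `Z` has no cells of dimension `≥ d`, `Z` is its own `(d-1)`-skeleton. [folklore] -/
theorem skeletonLT_eq_univ (hdim : ∀ m, d ≤ m → IsEmpty (RelCWComplex.cell (univ : Set Z) m)) :
    (RelCWComplex.skeletonLT (univ : Set Z) d : Set Z) = univ := by
  refine eq_univ_of_forall fun z => ?_
  have hz : z ∈ ⋃ (n : ℕ) (j : RelCWComplex.cell (univ : Set Z) n), RelCWComplex.closedCell n j := by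
    rw [CWComplex.union]; exact mem_univ z
  simp only [mem_iUnion] at hz
  obtain ⟨m, j, hj⟩ := hz
  exact RelCWComplex.closedCell_subset_skeletonLT m j |>.trans
    (RelCWComplex.skeletonLT_mono (by exact_mod_cast lt_of_cell hdim j)) hj

/-- **`Z ∪_φ ⊔ᵢ Dᵈ` is a CW complex** when `Z` is a Hausdorff CW complex with no cells of
dimension `≥ d` (so that the attaching maps land in the `(d-1)`-skeleton), for an arbitrary family
of attached `d`-discs: the cells are those of `Z` and one `d`-cell per disc (Hatcher, *Algebraic
Topology* (2002), p. 5: a CW complex is built by exactly such attachments, `Xⁿ = Xⁿ⁻¹ ∪ ⊔ eⁿ_α`;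
closure-finiteness of the new cells by Prop. A.1, weak topology by Prop. A.2).
[cite: HatcherAT2002, Ch. 0 p. 5, Prop. A.1, Prop. A.2] -/
instance instCWComplex [Fact (∀ m, d ≤ m → IsEmpty (RelCWComplex.cell (univ : Set Z) m))] :
    CWComplex (univ : Set (Space φ)) where
  cell := Cell φ
  map := cellMap φ
  source_eq := by
    rintro m (j | ⟨i, hi⟩)
    · rfl
    · have hi2 := hi.symm; subst hi2; rfl
  continuousOn := by
    rintro m (j | ⟨i, hi⟩)
    · rw [cellMap_inl, coe_oldMap]
      exact (inZ φ).continuous.comp_continuousOn (RelCWComplex.continuousOn m j)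
    · have hi2 := hi.symm; subst hi2
      rw [cellMap_inr, coe_newMap]; exact (continuous_chi φ i).continuousOn
  continuousOn_symm := by
    rintro m (j | ⟨i, hi⟩)
    · rw [cellMap_inl]
      show ContinuousOn (descFun φ (RelCWComplex.map m j).symm fun _ _ => (0 : Fin m → ℝ)) (inZ φ '' (RelCWComplex.map m j).target)
      rw [(isClosedEmbedding_inZ φ).isInducing.continuousOn_image_iff]
      exact RelCWComplex.continuousOn_symm m j
    · have hi2 := hi.symm; subst hi2
      rw [cellMap_inr]; exact continuousOn_newMap_symm φ i
  pairwiseDisjoint' := by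
    rintro ⟨m, c⟩ - ⟨m', c'⟩ - hne
    rcases c with j | ⟨i, hi⟩ <;> rcases c' with j' | ⟨i', hi'⟩
    · change Disjoint (oldMap φ m j '' ball 0 1) (oldMap φ m' j' '' ball 0 1)
      rw [image_oldMap, image_oldMap, Set.disjoint_image_iff (inZ_injective φ)]
      refine RelCWComplex.disjoint_openCell_of_ne fun h => hne ?_
      cases h; rfl
    · have hi2 := hi'.symm; subst hi2
      exact disjoint_image_oldMap_image_chi φ m j i'
    · have hi2 := hi.symm; subst hi2
      exact (disjoint_image_oldMap_image_chi φ m' j' i).symm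
    · have hi2 := hi.symm; subst hi2
      have hi3 := hi'.symm; subst hi3
      change Disjoint (chi φ i '' ball 0 1) (chi φ i' '' ball 0 1)
      refine Set.disjoint_left.2 ?_
      rintro _ ⟨y, hy, rfl⟩ ⟨y', hy', h⟩
      have := ((chi_eq_chi_iff φ hy' hy).1 h).1
      subst this
      exact hne rfl
  mapsTo' := by
    have hdim' : ∀ m, d ≤ m → IsEmpty (RelCWComplex.cell (univ : Set Z) m) := Fact.out
    rintro m (j | ⟨i, hi⟩)
    · obtain ⟨J, hJ⟩ := CWComplex.cellFrontier_subset_finite_closedCell (C := (univ : Set Z)) m j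
      classical
      refine ⟨fun n => (J n).image Sum.inl, fun y hy => ?_⟩
      have hmem : RelCWComplex.map m j y ∈ RelCWComplex.cellFrontier m j := ⟨y, hy, rfl⟩
      have h2 := hJ hmem
      simp only [mem_iUnion] at h2
      obtain ⟨n, hn, j', hj', hy'⟩ := h2
      rw [cellMap_inl, coe_oldMap]
      refine mem_iUnion.2 ⟨n, mem_iUnion.2 ⟨hn, mem_iUnion.2 ⟨Sum.inl j', mem_iUnion.2 ⟨Finset.mem_image_of_mem _ hj', ?_⟩⟩⟩⟩
      rw [cellMap_inl, image_oldMap]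
      exact mem_image_of_mem _ hy'
    · have hi2 := hi.symm; subst hi2
      -- the attaching sphere is compact, hence covered by finitely many closed cells of `Z`
      have hK : IsCompact (Set.range (φ i)) := by
        haveI : CompactSpace ↥(𝕊 d) := isCompact_iff_compactSpace.1 (isCompact_sphere _ _)
        exact isCompact_range (φ i).continuous
      obtain ⟨J, hJ⟩ := exists_finset_closedCell_cover_of_isCompact hK (k := d)
        (by rw [skeletonLT_eq_univ hdim']; exact subset_univ _)
      classical
      refine ⟨fun n => (J n).image Sum.inl, fun y hy => ?_⟩
      rw [cellMap_inr, coe_newMap, chi_of_mem_sphere φ i hy]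
      have h2 := hJ ⟨⟨y, hy⟩, rfl⟩
      simp only [mem_iUnion] at h2
      obtain ⟨n, hn, j', hj', hy'⟩ := h2
      refine mem_iUnion.2 ⟨n, mem_iUnion.2 ⟨hn, mem_iUnion.2 ⟨Sum.inl j', mem_iUnion.2 ⟨Finset.mem_image_of_mem _ hj', ?_⟩⟩⟩⟩
      rw [cellMap_inl, image_oldMap]
      exact mem_image_of_mem _ hy'
  closed' A _ hA := by
    rw [isClosed_iff]
    refine ⟨?_, fun i => ?_⟩
    · -- the trace on `Z` is closed by the weak topology of `Z`
      show IsClosed (inZ φ ⁻¹' A)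
      have hAZ : IsClosed (inZ φ ⁻¹' A) := by
        refine RelCWComplex.closed' (C := (univ : Set Z)) (D := ∅) _ (subset_univ _) ⟨fun n j => ?_, by simp⟩
        have heq : inZ φ ⁻¹' A ∩ RelCWComplex.map n j '' closedBall 0 1 = inZ φ ⁻¹' (A ∩ cellMap φ n (Sum.inl j) '' closedBall 0 1) := by
          rw [cellMap_inl, image_oldMap, preimage_inter, (inZ_injective φ).preimage_image]
        rw [heq]
        exact (hA n (Sum.inl j)).preimage (inZ φ).continuous
      exact hAZ
    · -- the trace on the `i`-th disc is the trace of `A ∩ ē_i`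
      have hd : IsClosed (A ∩ cellMap φ d (Sum.inr ⟨i, rfl⟩) '' closedBall 0 1) := hA d (Sum.inr ⟨i, rfl⟩)
      have heq : glue φ i ⁻¹' A = (fun x : ↥(𝔻 d) => chi φ i x) ⁻¹' (A ∩ cellMap φ d (Sum.inr ⟨i, rfl⟩) '' closedBall 0 1) := by
        ext x
        simp only [mem_preimage, mem_inter_iff, cellMap_inr, coe_newMap]
        rw [chi_of_mem φ i x.2]
        exact ⟨fun h => ⟨h, x, x.2, chi_of_mem φ i x.2⟩, fun h => h.1⟩
      rw [heq]
      exact hd.preimage ((continuous_chi φ i).comp continuous_subtype_val)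
  union' := by
    have hdim' : ∀ m, d ≤ m → IsEmpty (RelCWComplex.cell (univ : Set Z) m) := Fact.out
    refine eq_univ_of_forall fun m => ?_
    rcases exists_eq φ m with ⟨z, rfl⟩ | ⟨i, y, hy, rfl⟩
    · have hz : z ∈ ⋃ (n : ℕ) (j : RelCWComplex.cell (univ : Set Z) n), RelCWComplex.closedCell n j := by
        rw [CWComplex.union]; exact mem_univ z
      simp only [mem_iUnion] at hz
      obtain ⟨n, j, hj⟩ := hz
      refine mem_iUnion.2 ⟨n, mem_iUnion.2 ⟨Sum.inl j, ?_⟩⟩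
      rw [cellMap_inl, image_oldMap]
      exact mem_image_of_mem _ hj
    · refine mem_iUnion.2 ⟨d, mem_iUnion.2 ⟨Sum.inr ⟨i, rfl⟩, ?_⟩⟩
      rw [cellMap_inr, coe_newMap]
      exact ⟨y, ball_subset_closedBall hy, rfl⟩

/-! ### Bookkeeping: the cells, skeleta and cellularity of `inZ` -/

variable [Fact (∀ m, d ≤ m → IsEmpty (RelCWComplex.cell (univ : Set Z) m))]

/-- The open cell of an old cell is the image of the old open cell. [folklore] -/
theorem openCell_inl (m : ℕ) (j : RelCWComplex.cell (univ : Set Z) m) :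
    RelCWComplex.openCell (C := (univ : Set (Space φ))) m (Sum.inl j) = inZ φ '' RelCWComplex.openCell m j :=
  image_oldMap φ m j _

/-- The closed cell of an old cell is the image of the old closed cell. [folklore] -/
theorem closedCell_inl (m : ℕ) (j : RelCWComplex.cell (univ : Set Z) m) :
    RelCWComplex.closedCell (C := (univ : Set (Space φ))) m (Sum.inl j) = inZ φ '' RelCWComplex.closedCell m j :=
  image_oldMap φ m j _

/-- The open cell of a new cell. [folklore] -/
theorem openCell_inr (i : ι) :
    RelCWComplex.openCell (C := (univ : Set (Space φ))) d (Sum.inr ⟨i, rfl⟩) = chi φ i '' ball 0 1 := rfl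

/-- The closed cell of a new cell. [folklore] -/
theorem closedCell_inr (i : ι) :
    RelCWComplex.closedCell (C := (univ : Set (Space φ))) d (Sum.inr ⟨i, rfl⟩) = chi φ i '' closedBall 0 1 := rfl

/-- A dimension without cells in `Z`, other than `d`, has no cells in `Z ∪_φ ⊔ᵢ Dᵈ`. [folklore] -/
theorem isEmpty_cell {m : ℕ} (hZ : IsEmpty (RelCWComplex.cell (univ : Set Z) m)) (hm : m ≠ d) :
    IsEmpty (RelCWComplex.cell (univ : Set (Space φ)) m) := by
  haveI : IsEmpty {_i : ι // m = d} := ⟨fun x => hm x.2⟩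
  show IsEmpty (Cell φ m)
  unfold Cell; infer_instance

/-- **`inZ` maps skeleta into skeleta.** [folklore] -/
theorem image_inZ_skeletonLT_subset (n : ℕ∞) :
    inZ φ '' (RelCWComplex.skeletonLT (univ : Set Z) n : Set Z) ⊆ (RelCWComplex.skeletonLT (univ : Set (Space φ)) n : Set (Space φ)) := by
  rintro _ ⟨z, hz, rfl⟩
  obtain ⟨m, hm, j, hj⟩ := CWComplex.mem_skeletonLT_iff.1 hz
  refine CWComplex.mem_skeletonLT_iff.2 ⟨m, hm, Sum.inl j, ?_⟩
  rw [openCell_inl]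
  exact mem_image_of_mem _ hj

/-- **The cells of dimension `< k ≤ d` are old**: the `(k-1)`-skeleton of `Z ∪_φ ⊔ᵢ Dᵈ` is the
image of that of `Z`. [cite: HatcherAT2002, Ch. 0 p. 5] -/
theorem skeletonLT_subset_image_inZ {k : ℕ} (hk : k ≤ d) :
    (RelCWComplex.skeletonLT (univ : Set (Space φ)) k : Set (Space φ)) ⊆ inZ φ '' (RelCWComplex.skeletonLT (univ : Set Z) k : Set Z) := by
  intro x hx
  obtain ⟨m, hm, j, hj⟩ := CWComplex.mem_skeletonLT_iff.1 hx
  have hm' : m < k := by exact_mod_cast hm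
  rcases j with j | ⟨i, hi⟩
  · rw [openCell_inl] at hj
    obtain ⟨z, hz, rfl⟩ := hj
    exact mem_image_of_mem _ (CWComplex.mem_skeletonLT_iff.2 ⟨m, hm, j, hz⟩)
  · exact absurd hi (by omega)

/-- The `(k-1)`-skeleton of `Z ∪_φ ⊔ᵢ Dᵈ` for `k ≤ d` equals the image of that of `Z`. [folklore] -/
theorem skeletonLT_eq_image_inZ {k : ℕ} (hk : k ≤ d) :
    (RelCWComplex.skeletonLT (univ : Set (Space φ)) k : Set (Space φ)) = inZ φ '' (RelCWComplex.skeletonLT (univ : Set Z) k : Set Z) :=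
  Subset.antisymm (skeletonLT_subset_image_inZ φ hk) (image_inZ_skeletonLT_subset φ k)

/-- **`inZ` is a cellular map.** [folklore] -/
theorem isCellularMap_inZ : IsCellularMap (inZ φ) := fun _ =>
  mapsTo_iff_image_subset.2 (image_inZ_skeletonLT_subset φ _)

end CW

/-- `Z ∪_φ ⊔ᵢ Dᵈ` is nonempty when `Z` is. [folklore] -/
instance instNonempty [Nonempty Z] : Nonempty (Space φ) := ⟨inZ φ (Classical.arbitrary Z)⟩

end CellAttach

end Literature.AlgebraicTopology.Homotopy
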